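import Summits.AtomisticToContinuum.BoseEinsteinCondensation.Theses.BECRewardDescent
import Literature.MathematicalPhysics.QuantumManyBody.CondensateOccupationStability
import Literature.MathematicalPhysics.QuantumManyBody.JelliumSliceContinuity
import Literature.MathematicalPhysics.QuantumManyBody.PeriodicClusteringFromKyFanGap
import Literature.MathematicalPhysics.QuantumManyBody.PeriodicFormCauchySchwarz

/-!
# The condensate number operator `n̂₀ = a₀†a₀ = ∑ⱼ Pⱼ` on the cell and the variance bound for its
# polar form (crux `RewardChordBound`, stmt-AtomisticToContinuum-12876, stub `stub_modulusOfSimple`)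

For continuous Bose-symmetric `N = n+1`-body functions on the cell `Λ^N = [0,L)^{3N}`: `L²` bookkeeping
(expansion of `∫ ‖aF + bG‖²`, Cauchy–Schwarz); `a₀Ψ = modeAn L (constantMode L) Ψ` is continuous and
linear; **`a₀†a₀ = n̂₀ = L⁻³ ∑ⱼ ∫_Λ Ψ(X; xⱼ ↦ y) dy` on the cell** (Bose symmetry turns "insert at slot `0`,
remove slot `j`" into `Function.update`); the adjoint pairing `⟨a₀Φ, a₀Ψ⟩ = ⟨Φ, n̂₀Ψ⟩`, `⟨Ψ, n̂₀Ψ⟩ = n₀(Ψ)`;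
and **the variance bound for the polar form of `n₀`**: for a unit `Ψ` and `χ ⊥ Ψ`,
`|⟨a₀Ψ, a₀χ⟩|² ≤ ‖χ‖² (‖n̂₀Ψ‖² - n₀(Ψ)²)`, fed by the hypothesis `‖n̂₀Ψ‖² ≤ n₀(Ψ)² + V` of the route item
`CondensateVariance`. All `[folklore]`; no definitions.
-/

noncomputable section

namespace Summit.AtomisticToContinuum.BoseEinsteinCondensation.Cruxes.RewardChordBound.Birth.ModulusOfSimple

open MeasureTheory Filter
open scoped ENNReal NNReal ComplexConjugate
open Literature.MathematicalPhysics.QuantumManyBody.BoseGas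
open Literature.MathematicalPhysics.QuantumManyBody.JelliumBoseGas (cell_ae_eq_closedCube
  isCompact_closedCube)

/-! ### `L²` bookkeeping -/

section L2

variable {α : Type*} [MeasurableSpace α] {μ : Measure α} {F G : α → ℂ}
/-- `‖aF + bG‖² = |a|²‖F‖² + |b|²‖G‖² + 2 Re(ā b conj(F) G)` pointwise. [folklore] -/
theorem norm_sq_const_mul_add_const_mul (a b p q : ℂ) :
    ‖a * p + b * q‖ ^ 2 = ‖a‖ ^ 2 * ‖p‖ ^ 2 + ‖b‖ ^ 2 * ‖q‖ ^ 2 +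
      2 * (conj a * b * (conj p * q)).re := by
  have h : conj (a * p) * (b * q) = conj a * b * (conj p * q) := by
    rw [map_mul]; ring
  rw [norm_add_sq_complex, h, norm_mul, norm_mul, mul_pow, mul_pow]

/-- **Expansion of the mass of `aF + bG`** for `F, G ∈ L²`:
`∫ ‖aF + bG‖² = |a|² ∫‖F‖² + |b|² ∫‖G‖² + 2 Re(ā b ∫ conj(F) G)`. [folklore] -/
theorem integral_norm_sq_const_mul_add_const_mul (hF : MemLp F 2 μ) (hG : MemLp G 2 μ) (a b : ℂ) :
    ∫ x, ‖a * F x + b * G x‖ ^ 2 ∂μ =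
      ‖a‖ ^ 2 * ∫ x, ‖F x‖ ^ 2 ∂μ + ‖b‖ ^ 2 * ∫ x, ‖G x‖ ^ 2 ∂μ +
        2 * (conj a * b * ∫ x, conj (F x) * G x ∂μ).re := by
  simp_rw [norm_sq_const_mul_add_const_mul]
  have hiF : Integrable (fun x => ‖F x‖ ^ 2) μ := hF.integrable_norm_pow two_ne_zero
  have hiG : Integrable (fun x => ‖G x‖ ^ 2) μ := hG.integrable_norm_pow two_ne_zero
  have hiFG : Integrable (fun x => conj (F x) * G x) μ := integrable_conj_mul hF hG
  have hi3 : Integrable (fun x => 2 * (conj a * b * (conj (F x) * G x)).re) μ :=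
    ((hiFG.const_mul (conj a * b)).re).const_mul 2
  have hA : Integrable (fun x => ‖a‖ ^ 2 * ‖F x‖ ^ 2 + ‖b‖ ^ 2 * ‖G x‖ ^ 2) μ :=
    (hiF.const_mul _).add (hiG.const_mul _)
  rw [integral_add hA hi3, integral_add (hiF.const_mul _) (hiG.const_mul _), integral_const_mul,
    integral_const_mul, integral_const_mul]
  congr 1
  have h := integral_re (hiFG.const_mul (conj a * b))
  simp only [RCLike.re_to_complex] at h
  rw [h, integral_const_mul]

/-- **Cauchy–Schwarz** `|∫ conj(F) G|² ≤ ∫‖F‖² · ∫‖G‖²` for `F, G ∈ L²` (discriminant in `t`). [folklore] -/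
theorem norm_sq_integral_conj_mul_le (hF : MemLp F 2 μ) (hG : MemLp G 2 μ) :
    ‖∫ x, conj (F x) * G x ∂μ‖ ^ 2 ≤ (∫ x, ‖F x‖ ^ 2 ∂μ) * ∫ x, ‖G x‖ ^ 2 ∂μ := by
  set z : ℂ := ∫ x, conj (F x) * G x ∂μ with hz
  by_cases h0 : z = 0
  · rw [h0, norm_zero, zero_pow two_ne_zero]
    exact mul_nonneg (integral_nonneg fun _ => by positivity) (integral_nonneg fun _ => by positivity)
  set u : ℂ := conj z / (‖z‖ : ℂ) with hu
  have hzn : (‖z‖ : ℝ) ≠ 0 := norm_ne_zero_iff.mpr h0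
  have hzc : ((‖z‖ : ℝ) : ℂ) ≠ 0 := by exact_mod_cast hzn
  have hu1 : ‖u‖ = 1 := by
    rw [hu, norm_div, Complex.norm_conj, Complex.norm_real, Real.norm_of_nonneg (norm_nonneg _), div_self hzn]
  have huz : u * z = (‖z‖ : ℂ) := by
    rw [hu, div_mul_eq_mul_div, Complex.conj_mul', sq, mul_div_assoc, div_self hzc, mul_one]
  have hq : ∀ t : ℝ, 0 ≤ (∫ x, ‖F x‖ ^ 2 ∂μ) + 2 * t * ‖z‖ + t ^ 2 * ∫ x, ‖G x‖ ^ 2 ∂μ := by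
    intro t
    have h := integral_norm_sq_const_mul_add_const_mul hF hG 1 ((t : ℂ) * u)
    have hre : (conj (1 : ℂ) * ((t : ℂ) * u) * z).re = t * ‖z‖ := by
      rw [map_one, one_mul, mul_assoc, huz, ← Complex.ofReal_mul, Complex.ofReal_re]
    rw [hre, norm_one, one_pow, one_mul, norm_mul, Complex.norm_real, hu1, mul_one,
      Real.norm_eq_abs, sq_abs] at h
    calc (0 : ℝ) ≤ ∫ x, ‖1 * F x + (t : ℂ) * u * G x‖ ^ 2 ∂μ :=
          integral_nonneg fun _ => by positivity
      _ = _ := by rw [h]; ring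
  exact sq_le_mul_of_forall_quadratic_nonneg hq

end L2

/-! ### Continuity and square-integrability on the cell -/

section Cell

variable {N n : ℕ} {L : ℝ}
/-- A continuous function is in `L²` of the (bounded) cell `Λ^N`. [folklore] -/
theorem memLp_two_cellN_of_continuous {F : Config N → ℂ} (hF : Continuous F) (L : ℝ) :
    MemLp F 2 (volume.restrict (cellN N L)) :=
  memLp_two_of_lintegral_ne_top hF.aestronglyMeasurable
    (by rw [lintegral_cellN_nnnorm_sq_eq_ofReal L hF]; exact ENNReal.ofReal_ne_top)

/-- `∫_Λ conj(φ₀) f = L^{-3/2} ∫_Λ f` for the constant mode `φ₀ = L^{-3/2} 1_Λ`. [folklore] -/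
theorem setIntegral_cell_conj_constantMode_mul (L : ℝ) (f : Space → ℂ) :
    ∫ x in cell L, conj (constantMode L x) * f x =
      ((Real.sqrt (L ^ 3) : ℝ) : ℂ)⁻¹ * ∫ x in cell L, f x := by
  rw [← integral_const_mul]
  refine setIntegral_congr_fun (measurableSet_cell L) fun x hx => ?_
  simp only [constantMode, Set.indicator_of_mem hx, map_inv₀, Complex.conj_ofReal]

/-- **`a₀Ψ = √N L^{-3/2} ∫_Λ Ψ(x, ·) dx`.** [folklore] -/
theorem modeAn_constantMode_apply (L : ℝ) (Ψ : Config (n + 1) → ℂ) (Y : Config n) :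
    modeAn L (constantMode L) Ψ Y = ((Real.sqrt (n + 1) : ℝ) : ℂ) *
      (((Real.sqrt (L ^ 3) : ℝ) : ℂ)⁻¹ * ∫ x in cell L, Ψ (Matrix.vecCons x Y)) := by
  rw [modeAn_apply, setIntegral_cell_conj_constantMode_mul]

/-- `Y ↦ ∫_Λ Ψ(x, Y) dx` is continuous for continuous `Ψ` (integral over the compact closed cube). [folklore] -/
theorem continuous_setIntegral_cell_vecCons {Ψ : Config (n + 1) → ℂ} (hΨ : Continuous Ψ) (L : ℝ) :
    Continuous fun Y : Config n => ∫ x in cell L, Ψ (Matrix.vecCons x Y) := by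
  have hf : Continuous (Function.uncurry fun (Y : Config n) (x : Space) => Ψ (Matrix.vecCons x Y)) :=
    hΨ.comp (continuous_snd.matrixVecCons continuous_fst)
  have hc := continuous_parametric_integral_of_continuous (μ := volume) hf (isCompact_closedCube L)
  refine hc.congr fun Y => ?_
  exact (setIntegral_congr_set (cell_ae_eq_closedCube L)).symm

/-- `X ↦ ∫_Λ Ψ(X; xⱼ ↦ y) dy` is continuous for continuous `Ψ`. [folklore] -/
theorem continuous_setIntegral_cell_update {Ψ : Config N → ℂ} (hΨ : Continuous Ψ) (L : ℝ) (j : Fin N) :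
    Continuous fun X : Config N => ∫ y in cell L, Ψ (Function.update X j y) := by
  have hf : Continuous (Function.uncurry fun (X : Config N) (y : Space) => Ψ (Function.update X j y)) :=
    hΨ.comp (continuous_fst.update j continuous_snd)
  have hc := continuous_parametric_integral_of_continuous (μ := volume) hf (isCompact_closedCube L)
  refine hc.congr fun X => ?_
  exact (setIntegral_congr_set (cell_ae_eq_closedCube L)).symm

/-- `X ↦ ∑ⱼ ∫_Λ Ψ(X; xⱼ ↦ y) dy` (`L³ n̂₀Ψ`) is continuous for continuous `Ψ`. [folklore] -/
theorem continuous_sum_setIntegral_cell_update {Ψ : Config N → ℂ} (hΨ : Continuous Ψ) (L : ℝ) :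
    Continuous fun X : Config N => ∑ j : Fin N, ∫ y in cell L, Ψ (Function.update X j y) :=
  continuous_finsetSum _ fun j _ => continuous_setIntegral_cell_update hΨ L j

/-- **`a₀Ψ` is continuous** for continuous `Ψ`. [folklore] -/
theorem continuous_modeAn_constantMode {Ψ : Config (n + 1) → ℂ} (hΨ : Continuous Ψ) (L : ℝ) :
    Continuous (modeAn L (constantMode L) Ψ) := by
  have h : modeAn L (constantMode L) Ψ = fun Y => ((Real.sqrt (n + 1) : ℝ) : ℂ) *
      (((Real.sqrt (L ^ 3) : ℝ) : ℂ)⁻¹ * ∫ x in cell L, Ψ (Matrix.vecCons x Y)) := by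
    funext Y; exact modeAn_constantMode_apply L Ψ Y
  rw [h]
  exact continuous_const.mul (continuous_const.mul (continuous_setIntegral_cell_vecCons hΨ L))

end Cell

/-! ### `a₀†a₀ = n̂₀` on the cell -/

section NumberOperator

variable {n : ℕ} {L : ℝ}

/-- Inserting `y` in front of `X̂ⱼ` and rotating it to slot `j` is `X` with `xⱼ ↦ y`. [folklore] -/
theorem vecCons_removeNth_comp_cycleRange (j : Fin (n + 1)) (X : Config (n + 1)) (y : Space) :
    Matrix.vecCons y (j.removeNth X) ∘ j.cycleRange = Function.update X j y := by
  have h := vecCons_self_removeNth_comp_cycleRange j (Function.update X j y)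
  rwa [Function.update_self, Fin.removeNth_update] at h

/-- **`a₀†a₀Ψ = n̂₀Ψ = L⁻³ ∑ⱼ ∫_Λ Ψ(X; xⱼ ↦ y) dy` on the cell**, for Bose-symmetric `Ψ`. [folklore] -/
theorem modeCr_modeAn_constantMode_apply (hL : 0 < L) {Ψ : Config (n + 1) → ℂ}
    (hsymm : ∀ (σ : Equiv.Perm (Fin (n + 1))) (X : Config (n + 1)), Ψ (X ∘ σ) = Ψ X)
    {X : Config (n + 1)} (hX : X ∈ cellN (n + 1) L) :
    modeCr (constantMode L) (modeAn L (constantMode L) Ψ) X =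
      ((L ^ 3 : ℝ) : ℂ)⁻¹ * ∑ j : Fin (n + 1), ∫ y in cell L, Ψ (Function.update X j y) := by
  rw [modeCr_apply]
  simp only [modeAn_constantMode_apply]
  have hφ : ∀ j, constantMode L (X j) = ((Real.sqrt (L ^ 3) : ℝ) : ℂ)⁻¹ := fun j => by
    simp only [constantMode, Set.indicator_of_mem (hX j)]
  have hI : ∀ j : Fin (n + 1), ∫ x in cell L, Ψ (Matrix.vecCons x (j.removeNth X)) =
      ∫ y in cell L, Ψ (Function.update X j y) := fun j => by
    congr 1; funext y
    rw [← hsymm j.cycleRange (Matrix.vecCons y (j.removeNth X)), vecCons_removeNth_comp_cycleRange]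
  simp only [hφ, hI]
  have hs := sqrt_cast_ne_zero n
  have hL3 : (0 : ℝ) ≤ L ^ 3 := by positivity
  have hκ : ((Real.sqrt (L ^ 3) : ℝ) : ℂ)⁻¹ * ((Real.sqrt (L ^ 3) : ℝ) : ℂ)⁻¹ = ((L ^ 3 : ℝ) : ℂ)⁻¹ := by
    rw [← mul_inv, ← Complex.ofReal_mul, Real.mul_self_sqrt hL3]
  rw [Finset.mul_sum, Finset.mul_sum]
  refine Finset.sum_congr rfl fun j _ => ?_
  rw [← hκ]
  field_simp

/-- **Adjoint pairing `⟨a₀Φ, a₀Ψ⟩ = L⁻³ ⟨Φ, ∑ⱼ∫Ψ(update · j y)⟩ = ⟨Φ, n̂₀Ψ⟩`**, `Φ, Ψ` Bose-symmetric. [folklore] -/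
theorem integral_conj_modeAn_mul_modeAn (hL : 0 < L) {Φ Ψ : Config (n + 1) → ℂ}
    (hΦ : Continuous Φ) (hΨ : Continuous Ψ)
    (hΦs : ∀ (σ : Equiv.Perm (Fin (n + 1))) (X : Config (n + 1)), Φ (X ∘ σ) = Φ X)
    (hΨs : ∀ (σ : Equiv.Perm (Fin (n + 1))) (X : Config (n + 1)), Ψ (X ∘ σ) = Ψ X) :
    ∫ Y in cellN n L, conj (modeAn L (constantMode L) Φ Y) * modeAn L (constantMode L) Ψ Y =
      ((L ^ 3 : ℝ) : ℂ)⁻¹ * ∫ X in cellN (n + 1) L,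
        conj (Φ X) * ∑ j : Fin (n + 1), ∫ y in cell L, Ψ (Function.update X j y) := by
  rw [integral_conj_modeAn_mul (measurable_constantMode L) (norm_constantMode_le L)
    (continuous_modeAn_constantMode hΨ L) hΦ hΦs, ← integral_const_mul]
  refine setIntegral_congr_fun (measurableSet_cellN (n + 1) L) fun X hX => ?_
  rw [modeCr_modeAn_constantMode_apply hL hΨs hX]
  ring

/-- **`⟨Ψ, n̂₀Ψ⟩ = n₀(Ψ)`**: `∫ conj(Ψ) ∑ⱼ∫Ψ(update · j y) = L³ n₀(Ψ)` (`Ψ` Bose-symmetric). [folklore] -/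
theorem integral_conj_mul_sum_setIntegral_update (hL : 0 < L) {Ψ : Config (n + 1) → ℂ}
    (hΨ : Continuous Ψ)
    (hΨs : ∀ (σ : Equiv.Perm (Fin (n + 1))) (X : Config (n + 1)), Ψ (X ∘ σ) = Ψ X) :
    ∫ X in cellN (n + 1) L, conj (Ψ X) * ∑ j : Fin (n + 1), ∫ y in cell L, Ψ (Function.update X j y) =
      ((L ^ 3 * (condensateOccupation (n + 1) L Ψ).toReal : ℝ) : ℂ) := by
  have h := integral_conj_modeAn_mul_modeAn hL hΨ hΨ hΨs hΨs
  rw [integral_cellN_conj_mul_self L (continuous_modeAn_constantMode hΨ L),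
    ← condensateOccupation_eq_lintegral_modeAn_constantMode] at h
  have hL3 : ((L ^ 3 : ℝ) : ℂ) ≠ 0 := by exact_mod_cast (by positivity : L ^ 3 ≠ 0)
  have h' := h.symm
  rw [inv_mul_eq_iff_eq_mul₀ hL3] at h'
  rw [h', Complex.ofReal_mul]

/-- **Variance bound for the polar form of `n₀`.** For continuous Bose-symmetric `Ψ, χ` with `Ψ`
normalised and `χ ⊥ Ψ` in `L²(Λ^N)`:
`|⟨a₀Ψ, a₀χ⟩|² ≤ ‖χ‖² (L⁻⁶ ‖∑ⱼ∫Ψ(update · j y)‖² - n₀(Ψ)²) = ‖χ‖² (‖n̂₀Ψ‖² - ⟨n̂₀⟩²_Ψ)`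
(`⟨a₀Ψ, a₀χ⟩ = ⟨n̂₀Ψ - n₀Ψ, χ⟩` and Cauchy–Schwarz). [folklore] -/
theorem norm_sq_integral_conj_modeAn_mul_modeAn_le (hL : 0 < L) {Ψ χ : Config (n + 1) → ℂ}
    (hΨ : Continuous Ψ) (hχ : Continuous χ)
    (hΨs : ∀ (σ : Equiv.Perm (Fin (n + 1))) (X : Config (n + 1)), Ψ (X ∘ σ) = Ψ X)
    (hχs : ∀ (σ : Equiv.Perm (Fin (n + 1))) (X : Config (n + 1)), χ (X ∘ σ) = χ X)
    (hΨ1 : ∫⁻ X in cellN (n + 1) L, (‖Ψ X‖₊ : ℝ≥0∞) ^ 2 = 1)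
    (horth : ∫ X in cellN (n + 1) L, conj (Ψ X) * χ X = 0) :
    ‖∫ Y in cellN n L, conj (modeAn L (constantMode L) Ψ Y) * modeAn L (constantMode L) χ Y‖ ^ 2 ≤
      (∫ X in cellN (n + 1) L, ‖χ X‖ ^ 2) *
        ((L ^ 3)⁻¹ ^ 2 * (∫ X in cellN (n + 1) L,
            ‖∑ j : Fin (n + 1), ∫ y in cell L, Ψ (Function.update X j y)‖ ^ 2) -
          (condensateOccupation (n + 1) L Ψ).toReal ^ 2) := by
  set S : Config (n + 1) → ℂ := fun X => ∑ j : Fin (n + 1), ∫ y in cell L, Ψ (Function.update X j y)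
    with hS
  set ν : ℝ := (condensateOccupation (n + 1) L Ψ).toReal with hν
  have hSc : Continuous S := continuous_sum_setIntegral_cell_update hΨ L
  have hL3 : (0 : ℝ) < L ^ 3 := by positivity
  -- the pairing through the adjoint: `⟨a₀Ψ, a₀χ⟩ = L⁻³ conj ⟨χ, SΨ⟩ = L⁻³ ⟨SΨ, χ⟩`
  have hadj : ∫ Y in cellN n L, conj (modeAn L (constantMode L) Ψ Y) * modeAn L (constantMode L) χ Y =
      ((L ^ 3 : ℝ) : ℂ)⁻¹ * ∫ X in cellN (n + 1) L, conj (S X) * χ X := by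
    have h := integral_conj_modeAn_mul_modeAn hL hχ hΨ hχs hΨs
    have h2 : ∫ Y in cellN n L, conj (modeAn L (constantMode L) Ψ Y) * modeAn L (constantMode L) χ Y =
        conj (∫ Y in cellN n L, conj (modeAn L (constantMode L) χ Y) * modeAn L (constantMode L) Ψ Y) := by
      rw [← integral_conj]
      refine integral_congr_ae (Eventually.of_forall fun Y => ?_)
      simp only [map_mul, Complex.conj_conj, mul_comm]
    rw [h2, h, map_mul, map_inv₀, Complex.conj_ofReal, ← integral_conj]
    congr 1
    refine integral_congr_ae (Eventually.of_forall fun X => ?_)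
    simp only [map_mul, Complex.conj_conj, mul_comm, hS]
  -- `⟨SΨ, χ⟩ = ⟨SΨ - cΨ, χ⟩` with `c = L³ n₀`
  set c : ℝ := L ^ 3 * ν with hc
  have hΨm := memLp_two_cellN_of_continuous hΨ L
  have hχm := memLp_two_cellN_of_continuous hχ L
  have hSm := memLp_two_cellN_of_continuous hSc L
  have hDm : MemLp (fun X => 1 * S X + (-(c : ℂ)) * Ψ X) 2 (volume.restrict (cellN (n + 1) L)) :=
    memLp_two_cellN_of_continuous ((continuous_const.mul hSc).add (continuous_const.mul hΨ)) L
  have hshift : ∫ X in cellN (n + 1) L, conj (S X) * χ X =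
      ∫ X in cellN (n + 1) L, conj (1 * S X + (-(c : ℂ)) * Ψ X) * χ X := by
    have hi1 : Integrable (fun X => conj (S X) * χ X) (volume.restrict (cellN (n + 1) L)) :=
      integrable_conj_mul hSm hχm
    have hi2 : Integrable (fun X => (-(c : ℂ)) * (conj (Ψ X) * χ X)) (volume.restrict (cellN (n + 1) L)) :=
      (integrable_conj_mul hΨm hχm).const_mul _
    have hpt : (fun X => conj (1 * S X + (-(c : ℂ)) * Ψ X) * χ X) =
        fun X => conj (S X) * χ X + (-(c : ℂ)) * (conj (Ψ X) * χ X) := by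
      funext X
      simp only [map_add, map_mul, map_one, map_neg, Complex.conj_ofReal]
      ring
    rw [hpt, integral_add hi1 hi2, integral_const_mul, horth, mul_zero, add_zero]
  -- `‖SΨ - cΨ‖² = ‖SΨ‖² - L⁶ n₀²`
  have hmass : ∫ X in cellN (n + 1) L, ‖1 * S X + (-(c : ℂ)) * Ψ X‖ ^ 2 =
      (∫ X in cellN (n + 1) L, ‖S X‖ ^ 2) - (L ^ 3) ^ 2 * ν ^ 2 := by
    rw [integral_norm_sq_const_mul_add_const_mul hSm hΨm, integral_norm_sq_eq_toReal hΨ.aestronglyMeasurable,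
      hΨ1]
    have hSΨ : ∫ X in cellN (n + 1) L, conj (S X) * Ψ X = ((L ^ 3 * ν : ℝ) : ℂ) := by
      have h := integral_conj_mul_sum_setIntegral_update hL hΨ hΨs
      rw [← hν] at h
      rw [← Complex.conj_ofReal, ← h, ← integral_conj]
      refine integral_congr_ae (Eventually.of_forall fun X => ?_)
      simp only [map_mul, Complex.conj_conj, mul_comm, hS]
    rw [hSΨ, map_one, one_mul, norm_one, one_pow, one_mul, norm_neg, Complex.norm_real,
      Real.norm_eq_abs, sq_abs, ENNReal.toReal_one, mul_one, ← Complex.ofReal_neg,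
      ← Complex.ofReal_mul, Complex.ofReal_re, hc]
    ring
  -- Cauchy–Schwarz
  have hCS := norm_sq_integral_conj_mul_le hDm hχm
  rw [hmass] at hCS
  rw [hadj, hshift, norm_mul, norm_inv, Complex.norm_real, Real.norm_of_nonneg hL3.le, mul_pow]
  calc (L ^ 3)⁻¹ ^ 2 * ‖∫ X in cellN (n + 1) L, conj (1 * S X + (-(c : ℂ)) * Ψ X) * χ X‖ ^ 2
      ≤ (L ^ 3)⁻¹ ^ 2 * (((∫ X in cellN (n + 1) L, ‖S X‖ ^ 2) - (L ^ 3) ^ 2 * ν ^ 2) *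
          ∫ X in cellN (n + 1) L, ‖χ X‖ ^ 2) := by gcongr
    _ = _ := by field_simp; ring

/-! ### The polar form of `n₀ = ‖a₀ ·‖²` on a two-dimensional span -/

/-- `n₀(Ψ) < ∞` for a continuous `Ψ` (`n₀ ≤ N‖Ψ‖²`, bounded cell). [folklore] -/
theorem condensateOccupation_ne_top_of_continuous {N : ℕ} (hL : 0 < L) {Ψ : Config N → ℂ}
    (hΨ : Continuous Ψ) : condensateOccupation N L Ψ ≠ ⊤ := by
  refine ne_top_of_le_ne_top ?_ (condensateOccupation_le_card_mul_lintegral hL hΨ)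
  rw [lintegral_cellN_nnnorm_sq_eq_ofReal L hΨ]
  exact ENNReal.mul_ne_top (ENNReal.natCast_ne_top N) ENNReal.ofReal_ne_top

/-- **`a₀` is linear**: `a₀(au + bw) = a a₀u + b a₀w` for continuous `u, w`. [folklore] -/
theorem modeAn_constantMode_const_mul_add_const_mul {u w : Config (n + 1) → ℂ} (hu : Continuous u)
    (hw : Continuous w) (a b : ℂ) :
    modeAn L (constantMode L) (fun X => a * u X + b * w X) =
      fun Y => a * modeAn L (constantMode L) u Y + b * modeAn L (constantMode L) w Y := by
  have hφm := measurable_constantMode L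
  have hφb := norm_constantMode_le L
  have h1 : (fun X => a * u X + b * w X) = (a • u) + (b • w) := by
    funext X; simp
  rw [h1, modeAn_add L _ _ _
      (fun Y => integrableOn_cell_conj_mul hφm hφb (continuous_vecCons_slice (hu.const_smul a) Y))
      (fun Y => integrableOn_cell_conj_mul hφm hφb (continuous_vecCons_slice (hw.const_smul b) Y)),
    modeAn_smul, modeAn_smul]
  funext Y
  simp

/-- **Expansion of `n₀` on a span**: for continuous `u, w` and `a, b ∈ ℂ`,
`n₀(au + bw) = |a|² n₀(u) + |b|² n₀(w) + 2 Re(ā b ⟨a₀u, a₀w⟩)` (`n₀ = ‖a₀ ·‖²`, `a₀` linear).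
[folklore] -/
theorem toReal_condensateOccupation_const_mul_add_const_mul {u w : Config (n + 1) → ℂ}
    (hu : Continuous u) (hw : Continuous w) (a b : ℂ) :
    (condensateOccupation (n + 1) L (fun X => a * u X + b * w X)).toReal =
      ‖a‖ ^ 2 * (condensateOccupation (n + 1) L u).toReal +
        ‖b‖ ^ 2 * (condensateOccupation (n + 1) L w).toReal +
        2 * (conj a * b * ∫ Y in cellN n L,
          conj (modeAn L (constantMode L) u Y) * modeAn L (constantMode L) w Y).re := by
  have hAu := continuous_modeAn_constantMode hu L
  have hAw := continuous_modeAn_constantMode hw L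
  have hAuw : Continuous fun Y => a * modeAn L (constantMode L) u Y + b * modeAn L (constantMode L) w Y :=
    (continuous_const.mul hAu).add (continuous_const.mul hAw)
  rw [condensateOccupation_eq_lintegral_modeAn_constantMode,
    condensateOccupation_eq_lintegral_modeAn_constantMode,
    condensateOccupation_eq_lintegral_modeAn_constantMode,
    modeAn_constantMode_const_mul_add_const_mul hu hw,
    ← integral_norm_sq_eq_toReal hAuw.aestronglyMeasurable,
    ← integral_norm_sq_eq_toReal hAu.aestronglyMeasurable,
    ← integral_norm_sq_eq_toReal hAw.aestronglyMeasurable]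
  exact integral_norm_sq_const_mul_add_const_mul (memLp_two_cellN_of_continuous hAu L)
    (memLp_two_cellN_of_continuous hAw L) a b

/-! ### Feeding the variance hypothesis of `CondensateVariance` -/

/-- The `ℝ≥0∞` variance hypothesis `L⁻⁶ ‖∑ⱼ∫Ψ(update · j y)‖² ≤ n₀(Ψ)² + V` in real form:
`L⁻⁶ ∫ ‖∑ⱼ∫Ψ(update · j y)‖² - n₀(Ψ)² ≤ max V 0`. [folklore] -/
theorem variance_toReal_le_of_lintegral_le (hL : 0 < L) {Ψ : Config (n + 1) → ℂ} (hΨ : Continuous Ψ)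
    {V : ℝ} (hV : ENNReal.ofReal ((L ^ 3)⁻¹ ^ 2) * (∫⁻ X in cellN (n + 1) L,
      (‖∑ i : Fin (n + 1), ∫ y in cell L, Ψ (Function.update X i y)‖₊ : ℝ≥0∞) ^ 2) ≤
      condensateOccupation (n + 1) L Ψ ^ 2 + ENNReal.ofReal V) :
    (L ^ 3)⁻¹ ^ 2 * (∫ X in cellN (n + 1) L,
        ‖∑ j : Fin (n + 1), ∫ y in cell L, Ψ (Function.update X j y)‖ ^ 2) -
      (condensateOccupation (n + 1) L Ψ).toReal ^ 2 ≤ max V 0 := by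
  have hn := condensateOccupation_ne_top_of_continuous hL hΨ
  rw [lintegral_cellN_nnnorm_sq_eq_ofReal L (continuous_sum_setIntegral_cell_update hΨ L),
    ← ENNReal.ofReal_mul (sq_nonneg _), ← ENNReal.ofReal_toReal hn,
    ← ENNReal.ofReal_pow ENNReal.toReal_nonneg] at hV
  have h2 : ENNReal.ofReal ((condensateOccupation (n + 1) L Ψ).toReal ^ 2) + ENNReal.ofReal V ≤
      ENNReal.ofReal ((condensateOccupation (n + 1) L Ψ).toReal ^ 2 + max V 0) := by
    rw [ENNReal.ofReal_add (sq_nonneg _) (le_max_right _ _)]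
    gcongr
    exact le_max_left _ _
  have h3 := (ENNReal.ofReal_le_ofReal_iff (add_nonneg (sq_nonneg _) (le_max_right _ _))).1
    (hV.trans h2)
  linarith

/-- **The variance bound for the polar form of `n₀`, fed by `CondensateVariance`.** For continuous
Bose-symmetric `Ψ, χ` with `Ψ` normalised, `χ ⊥ Ψ`, and `‖n̂₀Ψ‖² ≤ n₀(Ψ)² + V` (the `ℝ≥0∞` form of
the route item): `|⟨a₀Ψ, a₀χ⟩|² ≤ ‖χ‖² max(V, 0)`. [folklore] -/
theorem norm_sq_polar_condensate_le_of_variance (hL : 0 < L) {Ψ χ : Config (n + 1) → ℂ}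
    (hΨ : Continuous Ψ) (hχ : Continuous χ)
    (hΨs : ∀ (σ : Equiv.Perm (Fin (n + 1))) (X : Config (n + 1)), Ψ (X ∘ σ) = Ψ X)
    (hχs : ∀ (σ : Equiv.Perm (Fin (n + 1))) (X : Config (n + 1)), χ (X ∘ σ) = χ X)
    (hΨ1 : ∫⁻ X in cellN (n + 1) L, (‖Ψ X‖₊ : ℝ≥0∞) ^ 2 = 1)
    (horth : ∫ X in cellN (n + 1) L, conj (Ψ X) * χ X = 0) {V : ℝ}
    (hV : ENNReal.ofReal ((L ^ 3)⁻¹ ^ 2) * (∫⁻ X in cellN (n + 1) L,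
      (‖∑ i : Fin (n + 1), ∫ y in cell L, Ψ (Function.update X i y)‖₊ : ℝ≥0∞) ^ 2) ≤
      condensateOccupation (n + 1) L Ψ ^ 2 + ENNReal.ofReal V) :
    ‖∫ Y in cellN n L, conj (modeAn L (constantMode L) Ψ Y) * modeAn L (constantMode L) χ Y‖ ^ 2 ≤
      (∫ X in cellN (n + 1) L, ‖χ X‖ ^ 2) * max V 0 :=
  (norm_sq_integral_conj_modeAn_mul_modeAn_le hL hΨ hχ hΨs hχs hΨ1 horth).trans
    (mul_le_mul_of_nonneg_left (variance_toReal_le_of_lintegral_le hL hΨ hV)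
      (integral_nonneg fun _ => sq_nonneg _))

end NumberOperator

end Summit.AtomisticToContinuum.BoseEinsteinCondensation.Cruxes.RewardChordBound.Birth.ModulusOfSimple

namespace Summit.AtomisticToContinuum.BoseEinsteinCondensation.Cruxes.RewardChordBound.Birth

/-- **Registered sub-goal of stub `stub_modulusOfSimple` (helper file 1): the variance bound for the polar form
of `n₀` through `n̂₀ = a₀†a₀`** — for continuous Bose-symmetric `Ψ, χ` on the cell with `Ψ` normalised, `χ ⊥ Ψ`
and `‖n̂₀Ψ‖² ≤ n₀(Ψ)² + V`: `|⟨a₀Ψ, a₀χ⟩|² ≤ ‖χ‖² max(V, 0)`. [folklore] -/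
theorem stub_modulusOfSimpleNumberOperator :
    ∀ (n : ℕ) (L : ℝ), 0 < L → ∀ (Ψ χ : Literature.MathematicalPhysics.QuantumManyBody.BoseGas.Config (n + 1) → ℂ), Continuous Ψ → Continuous χ → (∀ (σ : Equiv.Perm (Fin (n + 1))) (X : Literature.MathematicalPhysics.QuantumManyBody.BoseGas.Config (n + 1)), Ψ (X ∘ σ) = Ψ X) → (∀ (σ : Equiv.Perm (Fin (n + 1))) (X : Literature.MathematicalPhysics.QuantumManyBody.BoseGas.Config (n + 1)), χ (X ∘ σ) = χ X) → (∫⁻ X in Literature.MathematicalPhysics.QuantumManyBody.BoseGas.cellN (n + 1) L, (‖Ψ X‖₊ : ENNReal) ^ 2) = 1 → (∫ X in Literature.MathematicalPhysics.QuantumManyBody.BoseGas.cellN (n + 1) L, starRingEnd ℂ (Ψ X) * χ X) = 0 → ∀ V : ℝ, ENNReal.ofReal ((L ^ 3)⁻¹ ^ 2) * (∫⁻ X in Literature.MathematicalPhysics.QuantumManyBody.BoseGas.cellN (n + 1) L, (‖∑ i : Fin (n + 1), ∫ y in Literature.MathematicalPhysics.QuantumManyBody.BoseGas.cell L, Ψ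 (Function.update X i y)‖₊ : ENNReal) ^ 2) ≤ Literature.MathematicalPhysics.QuantumManyBody.BoseGas.condensateOccupation (n + 1) L Ψ ^ 2 + ENNReal.ofReal V → ‖∫ Y in Literature.MathematicalPhysics.QuantumManyBody.BoseGas.cellN n L, starRingEnd ℂ (Literature.MathematicalPhysics.QuantumManyBody.BoseGas.modeAn L (Literature.MathematicalPhysics.QuantumManyBody.BoseGas.constantMode L) Ψ Y) * Literature.MathematicalPhysics.QuantumManyBody.BoseGas.modeAn L (Literature.MathematicalPhysics.QuantumManyBody.BoseGas.constantMode L) χ Y‖ ^ 2 ≤ (∫ X in Literature.MathematicalPhysics.QuantumManyBody.BoseGas.cellN (n + 1) L, ‖χ X‖ ^ 2) * max V 0 :=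
  fun _ _ hL _ _ hΨ hχ hΨs hχs hΨ1 horth _ hV =>
    ModulusOfSimple.norm_sq_polar_condensate_le_of_variance hL hΨ hχ hΨs hχs hΨ1 horth hV

end Summit.AtomisticToContinuum.BoseEinsteinCondensation.Cruxes.RewardChordBound.Birth

end
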